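import Literature.MathematicalPhysics.QuantumFieldTheory.Balaban1983to89.B16Ineq197
import Literature.MathematicalPhysics.QuantumFieldTheory.Balaban1983to89.B14RelTreeLength

/-!
# `Balaban1983to89.B16Ineq197RelCubes` (v1) — the leaves `Anch194` ((1.94), the anchored exponential sum) and `Vol193`
(the volume count behind (1.93)) of the cell's typed (1.91) ⇒ (1.97) bookkeeping `…B16Ineq197.Polymer`
([Balaban1989LargeFieldII] pp. 388–389), DISCHARGED over unit b01's relative cube geometry
`…B14.RelAnimal.RelCubeSystem` BY NAME (`sumsum` = [Dimock2013BalabanII] App. E Lemma E.3 in the relative setting, and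
the Steiner-animal leaf `RelAnimalLeaf`), with the unconditional corollaries on the concrete ℤ^d windows of
`…B14.RelTreeLength` (leaf and degree bound PROVED there: c₀ = 4·2^d, Δ = 3^d − 1)

CITATION HEADER (lean-in-tree rule 2026-08-18).  Source under audit (cell paper B16): T. Bałaban, *Large field
renormalization. II. Localization, exponentiation, and bounds for the 𝐑 operation*, Commun. Math. Phys. **122**, 355–392
(1989), doi:10.1007/bf01238433 [Balaban1989LargeFieldII] (held `paper:balaban1989-cmp122-large-field-ii`; journal page =
PDF page + 354); every quotation below is read from the page renders `…1989-cmp122-large-field-II-p023/p033/p034/p035-x2.png`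
(pp. 377, 387, 388, 389) READ AS IMAGES by the typing unit.  Printed, p. 388 [PDF 34], after display (1.93) (whose volume
factors read *"exp(−(3·2^d)⁻¹βκM^{−d}|X′∖∪Y_i|) · Π_{h=1}^q exp((1 + β + (3·2^d)⁻¹β)κM^{−d}|X_{j_h}|)"*), verbatim: *"where we
have used the fact that α is sufficiently small, e.g., α^{1/3} ≦ exp(−(1+β)κ2d), to produce the exponential factors
connecting graphs in domains Y, in the cases they intersect outside Z′. The sum of the last products above is estimated in
the usual way: Σ_𝐃 Π_{Y∈𝐃} α^{2/3} exp(−½βκ d_{k,Z′}(Y)) = … ≦ c₀ exp Σ_{Y⊂X′} α^{1/3} exp(−½βκ d_{k,Z′}(Y))"*; p. 389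
[PDF 35], verbatim: *"≦ c₀ exp(Σ_{i:Y_i⊂X′} O(1)α^{1/3}M^{−d+1}|∂Y_i ∩ ∂(X′∖Y_i)| + Σ_{h=1}^q O(1)α^{1/3}M^{−d+1}|∂X_{j_h} ∩
∂(X′∖X_{j_h})|) ≦ c₀ exp O(1)α^{1/3}M^{−d}|X′∖Z′|, (1.94) … We have |X′∖Z′| ≦ |X′∖∪Y_i|, and we use the fact that
O(1)α^{1/3} ≦ 1 ≦ 1/(6·2^d)βκ for κ large enough"*; p. 388: *"Z′ = ∪_{i=1}^m Y_i ∪ ∪_{h=1}^q X_{j_h}"*; p. 377 [PDF 23],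
(1.68): *"|V(Y,(𝐔,𝐉))| ≦ α exp(−(1+2β)κ d_{k,Z}(Y)) (1.68) for Y∖Z~ ≠ ∅"*.  The published anchor of the relative anchored
bound is J. Dimock, *The renormalization group according to Bałaban. II. Large fields*, J. Math. Phys. **54** (2013) 092301,
arXiv:1212.5562v2, App. E Lemma E.3 (TeX L6914–6920): *"For □ ⊂ Ω and constants κ₀, K₀ = 𝒪(1): Σ_{X ∈ 𝒟_k(mod Ω^c), X ⊃ □}
exp(−κ₀ d_M(X, mod Ω^c)) ≦ K₀"* [Dimock2013BalabanII] — it enters ONLY through unit b01's kernel theorems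
`B14.RelAnimal.RelCubeSystem.sumsum` / `B14.RelTreeLength.Window.sumsum`, cited by name, not re-quoted as a fact.
The Bałaban papers are manuscripts UNDER ADJUDICATION by the audit cell `pub-balaban`: NOTHING printed in them is asserted
here.  In the cell's typed bookkeeping `…B16Ineq197` (unit b02, gen 14; tree v1.1) the two printed steps above are the
quoted LEAVES `Polymer.Anch194 : Σ_{Y∈Ycat} α^{1/3}e^{−½βκ·dY(Y)} ≤ C₁·α^{1/3}·v` and `Polymer.Vol193 : ∀ (S,𝐃) ∈ adm, v ≤
Σ_{Y∈𝐃}(a₁·dY(Y) + a₀) + Σ_{j∈S} vol j` (v = M^{−d}|X′∖⋃Y_i|, dY(Y) = d_{k,Z′}(Y) = d_{k,Z}(Y) for Y ⊂ X′ — cell GAPS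
C-adv7-85 (a): Z ∩ X′ ⊂ Z′ ⊂ Z).  This module proves them from unit b01's relative cube geometry under NAMED INCIDENCE
HYPOTHESES (binders; the cell's certified reading of pp. 377/387/388, GAPS C-adv7-85 (a)–(d), C-adv6-51 (4), is what makes
them hold in the intended model — it is NOT asserted): for `Anch194`, a family U′ of cubes OUTSIDE Z with #U′ ≤ v such that
every catalogued Y contains a cube of U′ (intended: U′ = the M-cubes of X′∖Z; every Y of the catalogue has Y∖Z~ ≠ ∅ by
(1.68) and lies in X′, and |X′∖Z| ≤ |X′∖∪Y_i| is the printed *"|X′∖Z′| ≦ |X′∖∪Y_i|"*); for `Vol193`, a family U with v ≤ #U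
covered, for every admissible pair (S,𝐃), by the small parts Y∖Z (Y ∈ 𝐃) and cube families of the X_j (j ∈ S) of size ≤
vol j (intended: U = the M-cubes of X′∖⋃Y_i; p. 387 [PDF 33] *"Each term determines the localization domain X′₀ = ∪_{Y∈𝐃} Y ∪
∪_{j=1}^n X_j"*, p. 388 *"Here the summation is over {X_{j_1},…,X_{j_q}} and 𝐃 such that the connected localization domain they
determine is equal to X′"*, with C-adv7-85 (a): a cube of X′∖⋃Y_i in no X_{j_h} lies in some Y ∈ 𝐃 and outside Z).  DIFFERENCE FROM THE
PRINT, recorded: the print anchors the Y's at boundary FACES of the pieces of Z′ (M^{−d+1}|∂…|, then ≤ 2d faces per cube of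
X′∖Z′, C-adv7-85 (c)); the typed leaf is already in volume form, and this module anchors at CUBES of X′∖Z directly, so its
constant is b01's K_rel itself (no factor 2d) — a by-name SUFFICIENT condition for the leaf, not a transcription of the
face route.

WHAT IS PROVED (no `sorry`, no new axioms; [folklore] = elementary finite sums): `sum_le_sum_sum_of_anchored` — anchored
regrouping Σ_{Y∈T} f ≤ Σ_{c∈U} Σ_{Y∈fam c} f (f ≥ 0, every Y ∈ T in some fam c, c ∈ U); `anch194_of_sumsum` — for a
relative cube system G (unit b01) with degree ≤ Δ and the animal leaf at c₀, a polymer P of `B16Ineq197` over the same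
domains with Ycat ⊆ G.adm and dY = d_rel on Ycat, anchors U′ as above, and constants with ½βκ ≥ kapparel(c₀,Δ), C₁ ≥
K_rel(c₀,Δ), α ≥ 0: `P.Anch194 K`; `card_small_le` — #(Y∖Z) ≤ c₀(1 + d_rel(Y)) from the leaf; `vol193_of_relAnimalLeaf` —
the cover hypothesis and a₁, a₀ ≥ c₀ give `P.Vol193 K`; `leaves_of_relCubes` — both at once from ONE cube family U with
#U = v (U′ = the cubes of U outside Z); the WINDOW corollaries `anch194_window`, `vol193_window` on b01's concrete carrier
`B14.RelTreeLength.Window d` (leaf c₀ = 4·2^d and Δ = 3^d − 1 PROVED there), and `anch194_window_four` (d = 4: the clause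
reads ½βκ ≥ 4215 > kapparel(64, 80), b01's `kapparel_four_lt`); non-vacuity `toy_anch194` / `toy_vol193` on a two-cube
abstract carrier (one small cube, one large-field cube, one admissible domain).
WHAT IS *NOT* PROVED: the incidence hypotheses themselves (lattice geometry of the 𝐑-operation carriers, pp. 377–388 — not
typed in the cell; they stay binders for the joiner), the other leaves of `B16Ineq197` (`Subadd193` — the relative tree
GLUING through junctions outside Z′, which needs glued segment graphs in pv22's `TreeLength` model; `XBudget`; `Count196` is
`…B16Count196Packing`), and any optimisation of constants: on the window carrier the clauses read a₁, a₀ ≥ 4·2^d (print's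
rate presupposes 3·2^{d−1}, 2^d; with a₁ = 4·2^d the slope clause `lam·a₁ ≤ ½` of `B16Ineq197.Consts.Small` wants lam ≤
(8·2^d)⁻¹, the value already recorded in cell SMALLNESS S-B16.12 ⟦v2.26⟧ (c)) and C₁ ≥ K_rel(4·2^d, 3^d−1) =
e^{kapparel}(3^d)⁻² (d = 4: e^{64(log 13122 + 81 log 2)}/6561, kapparel < 4215), so the clause `cancel_κ` (2C₁α^{1/3} ≤ ¼lam·βκ)
makes the k-INDEPENDENT α of (1.68) correspondingly small — print: *"O(1)"*, *"κ large enough"*, *"α … arbitrarily small"*.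
Value: two quoted leaves of the (1.97) bookkeeping become kernel theorems over b01's relative geometry modulo named
incidences; NOT summit progress.  Cell records: GAPS.md C-b02g15-1; HOME/HANDOFF.md (b02 lineage, gen 15).  Naming:
`B16Ineq197.Consts` ∕ `B16Ineq197.Polymer` written QUALIFIED (the Setup module's `…Balaban1983to89.Consts` shadows the
short name here, cf. `B16Ineq197` header note N1).
-/

namespace Literature.MathematicalPhysics.QuantumFieldTheory.Balaban1983to89.B16Ineq197RelCubes

open Finset
open Literature.MathematicalPhysics.QuantumFieldTheory.Balaban1983to89.B14.RelAnimal (RelCubeSystem kapparel Krel Krel_pos)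
open Literature.MathematicalPhysics.QuantumFieldTheory.Balaban1983to89.TreeLengthCubeSystem (Cell cellsOf mem_cellsOf)
open Literature.Probability.LatticeModels (IsRConnected)

noncomputable section

/-! ## Part A. Anchored regrouping -/

/-- **Anchored regrouping.** If every `Y ∈ T` lies in the family `fam c` of some anchor `c ∈ U`, and `f ≥ 0` on the
families, then `Σ_{Y∈T} f(Y) ≤ Σ_{c∈U} Σ_{Y∈fam c} f(Y)` (each Y is counted at least once on the right). [folklore] -/
theorem sum_le_sum_sum_of_anchored {ι C : Type*} (T : Finset ι) (U : Finset C) (fam : C → Finset ι) (f : ι → ℝ)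
    (hf : ∀ c ∈ U, ∀ Y ∈ fam c, 0 ≤ f Y) (hanch : ∀ Y ∈ T, ∃ c ∈ U, Y ∈ fam c) :
    ∑ Y ∈ T, f Y ≤ ∑ c ∈ U, ∑ Y ∈ fam c, f Y := by
  classical
  have h1 : ∀ Y ∈ T, f Y ≤ ∑ c ∈ U, (if Y ∈ fam c then f Y else 0) := by
    intro Y hY
    obtain ⟨c, hcU, hYc⟩ := hanch Y hY
    have hfY : 0 ≤ f Y := hf c hcU Y hYc
    have h := Finset.single_le_sum (s := U) (f := fun c' => if Y ∈ fam c' then f Y else 0)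
      (fun c' _ => by
        by_cases h : Y ∈ fam c'
        · simp only [if_pos h]; exact hfY
        · simp only [if_neg h]; exact le_rfl) hcU
    simpa only [if_pos hYc] using h
  have h2 : ∀ c ∈ U, ∑ Y ∈ T, (if Y ∈ fam c then f Y else 0) ≤ ∑ Y ∈ fam c, f Y := by
    intro c hc
    rw [← Finset.sum_filter]
    exact Finset.sum_le_sum_of_subset_of_nonneg (fun Y hY => (Finset.mem_filter.1 hY).2)
      (fun Y hY _ => hf c hc Y hY)
  calc ∑ Y ∈ T, f Y ≤ ∑ Y ∈ T, ∑ c ∈ U, (if Y ∈ fam c then f Y else 0) := Finset.sum_le_sum h1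
    _ = ∑ c ∈ U, ∑ Y ∈ T, (if Y ∈ fam c then f Y else 0) := Finset.sum_comm
    _ ≤ ∑ c ∈ U, ∑ Y ∈ fam c, f Y := Finset.sum_le_sum h2

/-! ## Part B. (1.94): the anchored sum `Anch194` from b01's relative anchored bound `sumsum` -/

variable {S : B16.RelDomainSys}

/-- **(1.94), the leaf `Anch194`, from the relative anchored tree-graph bound.** Print: *"≦ c₀ exp Σ_{Y⊂X′} α^{1/3}
exp(−½βκ d_{k,Z′}(Y)) ≦ … ≦ c₀ exp O(1)α^{1/3}M^{−d}|X′∖Z′|"*, *"|X′∖Z′| ≦ |X′∖∪Y_i|"*.  Typed: every catalogued Y is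
admissible for b01's resummed class and contains an anchor cube `c ∈ U′`, the anchors lie outside `Z` and number `≤ v`;
regroup by anchors (`sum_le_sum_sum_of_anchored`), bound each anchored sum by `RelCubeSystem.sumsum` (≤ K_rel(c₀,Δ) once
½βκ ≥ kapparel(c₀,Δ)), and use #U′ ≤ v, K_rel ≤ C₁. [cite: Balaban1989LargeFieldII, (1.94) p.389] -/
theorem anch194_of_sumsum (G : RelCubeSystem S) {Δ : ℕ} (hΔ : G.DegreeLE Δ) {c₀ : ℝ} (hL : G.RelAnimalLeaf c₀)
    {LF : Type*} (P : B16Ineq197.Polymer LF S.Dom) (K : B16Ineq197.Consts) (hα : 0 ≤ K.α)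
    (hYcat : P.Ycat ⊆ G.adm) (hdY : ∀ Y ∈ P.Ycat, P.dY Y = S.dRel Y)
    (U' : Finset G.Cube) (hU'Z : ∀ c ∈ U', c ∉ G.Z) (hU'v : (U'.card : ℝ) ≤ P.v)
    (hanch : ∀ Y ∈ P.Ycat, ∃ c ∈ U', c ∈ G.cubes Y)
    (hκ : kapparel c₀ Δ ≤ K.β * K.κ / 2) (hC₁ : Krel c₀ Δ ≤ K.C₁) : P.Anch194 K := by
  have step1 : ∑ Y ∈ P.Ycat, K.w₁ (P.dY Y) =
      K.α ^ (1 / 3 : ℝ) * ∑ Y ∈ P.Ycat, Real.exp (-(K.β * K.κ / 2) * S.dRel Y) := by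
    rw [Finset.mul_sum]
    refine Finset.sum_congr rfl fun Y hY => ?_
    simp only [B16Ineq197.Consts.w₁, hdY Y hY]
  have step2 : ∑ Y ∈ P.Ycat, Real.exp (-(K.β * K.κ / 2) * S.dRel Y) ≤
      ∑ c ∈ U', ∑ Y ∈ G.adm.filter (fun X => c ∈ G.cubes X), Real.exp (-(K.β * K.κ / 2) * S.dRel Y) :=
    sum_le_sum_sum_of_anchored P.Ycat U' (fun c => G.adm.filter (fun X => c ∈ G.cubes X))
      (fun Y => Real.exp (-(K.β * K.κ / 2) * S.dRel Y)) (fun _ _ Y _ => (Real.exp_pos _).le)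
      fun Y hY => by
        obtain ⟨c, hc, hcY⟩ := hanch Y hY
        exact ⟨c, hc, Finset.mem_filter.2 ⟨hYcat hY, hcY⟩⟩
  have step3 : ∑ c ∈ U', ∑ Y ∈ G.adm.filter (fun X => c ∈ G.cubes X), Real.exp (-(K.β * K.κ / 2) * S.dRel Y) ≤
      U'.card * Krel c₀ Δ := by
    have h : ∀ c ∈ U', ∑ Y ∈ G.adm.filter (fun X => c ∈ G.cubes X), Real.exp (-(K.β * K.κ / 2) * S.dRel Y) ≤
        Krel c₀ Δ := fun c hc => G.sumsum hΔ hL hκ c (hU'Z c hc)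
    calc _ ≤ ∑ _c ∈ U', Krel c₀ Δ := Finset.sum_le_sum h
      _ = U'.card * Krel c₀ Δ := by rw [Finset.sum_const, nsmul_eq_mul]
  have step4 : (U'.card : ℝ) * Krel c₀ Δ ≤ P.v * K.C₁ := mul_le_mul hU'v hC₁ (Krel_pos c₀ Δ).le P.v_nonneg
  have hα3 : 0 ≤ K.α ^ (1 / 3 : ℝ) := Real.rpow_nonneg hα _
  show ∑ Y ∈ P.Ycat, K.w₁ (P.dY Y) ≤ K.C₁ * K.α ^ (1 / 3 : ℝ) * P.v
  calc ∑ Y ∈ P.Ycat, K.w₁ (P.dY Y)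
        = K.α ^ (1 / 3 : ℝ) * ∑ Y ∈ P.Ycat, Real.exp (-(K.β * K.κ / 2) * S.dRel Y) := step1
    _ ≤ K.α ^ (1 / 3 : ℝ) * (P.v * K.C₁) := mul_le_mul_of_nonneg_left (step2.trans (step3.trans step4)) hα3
    _ = K.C₁ * K.α ^ (1 / 3 : ℝ) * P.v := by ring

/-! ## Part C. (1.93): the volume count `Vol193` from b01's Steiner-animal leaf -/

/-- The small-field part of a domain has at most `c₀(1 + d_rel(Y))` cubes under the animal leaf (the animal contains
`Y∖Z`; for `Y∖Z = ∅` the bound is `0 ≤ c₀(1 + d_rel)`). [cite: Dimock2013BalabanII, App. E Lemma E.1(3)] -/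
theorem card_small_le (G : RelCubeSystem S) {c₀ : ℝ} (hL : G.RelAnimalLeaf c₀) (hc₀ : 0 ≤ c₀) (Y : S.Dom) :
    ((G.small Y).card : ℝ) ≤ c₀ * (1 + S.dRel Y) := by
  by_cases h : (G.small Y).Nonempty
  · obtain ⟨hSA, -, -, hA⟩ := G.animal_spec hL h
    exact le_trans (by exact_mod_cast Finset.card_le_card hSA) hA
  · rw [Finset.not_nonempty_iff_eq_empty.1 h, Finset.card_empty, Nat.cast_zero]
    exact mul_nonneg hc₀ (by linarith [S.dRel_nonneg Y])

/-- **The volume count behind (1.93), the leaf `Vol193`, from the animal leaf.** Print: the factor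
*"exp(−(3·2^d)⁻¹βκM^{−d}|X′∖∪Y_i|)"* of (1.93) is produced from the ½β-parts of the decay of the Y ∈ 𝐃 and the volume
terms of the X_{j_h}, i.e. `M^{−d}|X′∖⋃Y_i| ≤ Σ_{Y∈𝐃}(a₁d(Y) + a₀) + Σ_h M^{−d}|X_{j_h}|`.  Typed: a cube family U with v ≤ #U
is covered, for each admissible pair (S,𝐃), by the small parts `Y∖Z`, Y ∈ 𝐃, and families `Xc j`, j ∈ S, with #(Xc j) ≤
vol j; each small part has ≤ c₀(1 + d(Y)) cubes (`card_small_le`), and c₀ ≤ a₁, c₀ ≤ a₀. [cite: Balaban1989LargeFieldII, (1.93) p.388] -/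
theorem vol193_of_relAnimalLeaf (G : RelCubeSystem S) {c₀ : ℝ} (hL : G.RelAnimalLeaf c₀) (hc₀ : 0 ≤ c₀)
    {LF : Type*} (P : B16Ineq197.Polymer LF S.Dom) (K : B16Ineq197.Consts)
    (hdY : ∀ Y ∈ P.Ycat, P.dY Y = S.dRel Y)
    (U : Finset G.Cube) (hUv : P.v ≤ U.card) (Xc : LF → Finset G.Cube)
    (hvol : ∀ j ∈ P.cand, ((Xc j).card : ℝ) ≤ P.vol j)
    (hcover : ∀ p ∈ P.adm, ∀ c ∈ U, (∃ Y ∈ p.2, c ∈ G.small Y) ∨ ∃ j ∈ p.1, c ∈ Xc j)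
    (ha₁ : c₀ ≤ K.a₁) (ha₀ : c₀ ≤ K.a₀) : P.Vol193 K := by
  intro p hp
  have hsub : U ⊆ p.2.biUnion G.small ∪ p.1.biUnion Xc := by
    intro c hc
    rcases hcover p hp c hc with ⟨Y, hY, hcY⟩ | ⟨j, hj, hcj⟩
    · exact Finset.mem_union_left _ (Finset.mem_biUnion.2 ⟨Y, hY, hcY⟩)
    · exact Finset.mem_union_right _ (Finset.mem_biUnion.2 ⟨j, hj, hcj⟩)
  have hcardN : U.card ≤ ∑ Y ∈ p.2, (G.small Y).card + ∑ j ∈ p.1, (Xc j).card :=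
    (Finset.card_le_card hsub).trans ((Finset.card_union_le _ _).trans
      (add_le_add Finset.card_biUnion_le Finset.card_biUnion_le))
  have hcard : (U.card : ℝ) ≤ ∑ Y ∈ p.2, ((G.small Y).card : ℝ) + ∑ j ∈ p.1, ((Xc j).card : ℝ) := by
    exact_mod_cast hcardN
  have hY : ∀ Y ∈ p.2, ((G.small Y).card : ℝ) ≤ K.a₁ * P.dY Y + K.a₀ := by
    intro Y hY
    have hYc : Y ∈ P.Ycat := P.adm_snd p hp hY
    have hd : 0 ≤ P.dY Y := P.dY_nonneg Y hYc
    calc ((G.small Y).card : ℝ) ≤ c₀ * (1 + S.dRel Y) := card_small_le G hL hc₀ Y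
      _ = c₀ * P.dY Y + c₀ := by rw [← hdY Y hYc]; ring
      _ ≤ K.a₁ * P.dY Y + K.a₀ := add_le_add (mul_le_mul_of_nonneg_right ha₁ hd) ha₀
  have hX : ∀ j ∈ p.1, ((Xc j).card : ℝ) ≤ P.vol j := fun j hj => hvol j (P.adm_fst p hp hj)
  calc P.v ≤ U.card := hUv
    _ ≤ _ := hcard
    _ ≤ ∑ Y ∈ p.2, (K.a₁ * P.dY Y + K.a₀) + ∑ j ∈ p.1, P.vol j :=
      add_le_add (Finset.sum_le_sum hY) (Finset.sum_le_sum hX)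

/-! ## Part D. Both leaves from ONE cube family (U = the M-cubes of X′∖⋃Y_i, #U = v; anchors = its cubes outside Z) -/

/-- **`Anch194` and `Vol193` together** from one cube family `U` with `#U = v`: the anchors are the cubes of U outside Z
(every catalogued Y contains one — intended: Y∖Z~ ≠ ∅, p. 377), the cover is that of `vol193_of_relAnimalLeaf`.
[cite: Balaban1989LargeFieldII, (1.93)-(1.94) pp.388-389] -/
theorem leaves_of_relCubes (G : RelCubeSystem S) {Δ : ℕ} (hΔ : G.DegreeLE Δ) {c₀ : ℝ} (hL : G.RelAnimalLeaf c₀)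
    (hc₀ : 0 ≤ c₀) {LF : Type*} (P : B16Ineq197.Polymer LF S.Dom) (K : B16Ineq197.Consts) (hα : 0 ≤ K.α)
    (hYcat : P.Ycat ⊆ G.adm) (hdY : ∀ Y ∈ P.Ycat, P.dY Y = S.dRel Y)
    (U : Finset G.Cube) (hUv : P.v = U.card)
    (hanch : ∀ Y ∈ P.Ycat, ∃ c ∈ U, c ∉ G.Z ∧ c ∈ G.cubes Y)
    (Xc : LF → Finset G.Cube) (hvol : ∀ j ∈ P.cand, ((Xc j).card : ℝ) ≤ P.vol j)
    (hcover : ∀ p ∈ P.adm, ∀ c ∈ U, (∃ Y ∈ p.2, c ∈ G.small Y) ∨ ∃ j ∈ p.1, c ∈ Xc j)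
    (hκ : kapparel c₀ Δ ≤ K.β * K.κ / 2) (hC₁ : Krel c₀ Δ ≤ K.C₁) (ha₁ : c₀ ≤ K.a₁) (ha₀ : c₀ ≤ K.a₀) :
    P.Anch194 K ∧ P.Vol193 K := by
  refine ⟨?_, vol193_of_relAnimalLeaf G hL hc₀ P K hdY U hUv.le Xc hvol hcover ha₁ ha₀⟩
  refine anch194_of_sumsum G hΔ hL P K hα hYcat hdY (U.filter fun c => c ∉ G.Z)
    (fun c hc => (Finset.mem_filter.1 hc).2) ?_ ?_ hκ hC₁
  · rw [hUv]
    exact_mod_cast Finset.card_filter_le U _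
  · intro Y hY
    obtain ⟨c, hcU, hcZ, hcY⟩ := hanch Y hY
    exact ⟨c, Finset.mem_filter.2 ⟨hcU, hcZ⟩, hcY⟩

/-! ## Part E. The corollaries on b01's concrete ℤ^d windows (`B14.RelTreeLength.Window`: leaf and degree bound proved) -/

variable {d : ℕ}

/-- **(1.94) on the concrete carrier**, unconditional in the geometry: for a window W of ℤ^d cubes (b01), a polymer over
its localization domains with Ycat ⊆ the resummed class and dY = d_rel, anchors U′ = cells outside Z_W numbering ≤ v and
met by every catalogued Y, and constants with ½βκ ≥ kapparel(4·2^d, 3^d−1), C₁ ≥ K_rel(4·2^d, 3^d−1), α ≥ 0: `P.Anch194 K`.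
[cite: Balaban1989LargeFieldII, (1.94) p.389] -/
theorem anch194_window (W : B14.RelTreeLength.Window d) {LF : Type*} (P : B16Ineq197.Polymer LF W.relSys.Dom)
    (K : B16Ineq197.Consts) (hα : 0 ≤ K.α) (hYcat : P.Ycat ⊆ W.relCubeSys.adm)
    (hdY : ∀ Y ∈ P.Ycat, P.dY Y = W.relSys.dRel Y)
    (U' : Finset (Cell W.B)) (hU'Z : ∀ c ∈ U', c.1 ∉ W.Z) (hU'v : (U'.card : ℝ) ≤ P.v)
    (hanch : ∀ Y ∈ P.Ycat, ∃ c ∈ U', c.1 ∈ Y.1)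
    (hκ : kapparel (4 * 2 ^ d) (3 ^ d - 1) ≤ K.β * K.κ / 2) (hC₁ : Krel (4 * 2 ^ d) (3 ^ d - 1) ≤ K.C₁) :
    P.Anch194 K :=
  anch194_of_sumsum W.relCubeSys W.degreeLE W.relAnimalLeaf P K hα hYcat hdY U'
    (fun c hc h => hU'Z c hc (mem_cellsOf.1 h)) hU'v
    (fun Y hY => by
      obtain ⟨c, hc, hcY⟩ := hanch Y hY
      exact ⟨c, hc, mem_cellsOf.2 hcY⟩) hκ hC₁

/-- **(1.94) on the concrete carrier, d = 4**: the κ-clause reads ½βκ ≥ 4215 (> kapparel(64, 80), b01's `kapparel_four_lt`).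
[cite: Balaban1989LargeFieldII, (1.94) p.389] -/
theorem anch194_window_four (W : B14.RelTreeLength.Window 4) {LF : Type*} (P : B16Ineq197.Polymer LF W.relSys.Dom)
    (K : B16Ineq197.Consts) (hα : 0 ≤ K.α) (hYcat : P.Ycat ⊆ W.relCubeSys.adm)
    (hdY : ∀ Y ∈ P.Ycat, P.dY Y = W.relSys.dRel Y)
    (U' : Finset (Cell W.B)) (hU'Z : ∀ c ∈ U', c.1 ∉ W.Z) (hU'v : (U'.card : ℝ) ≤ P.v)
    (hanch : ∀ Y ∈ P.Ycat, ∃ c ∈ U', c.1 ∈ Y.1)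
    (hκ : 4215 ≤ K.β * K.κ / 2) (hC₁ : Krel (4 * 2 ^ 4) (3 ^ 4 - 1) ≤ K.C₁) : P.Anch194 K :=
  anch194_window W P K hα hYcat hdY U' hU'Z hU'v hanch
    ((B14.RelTreeLength.Window.kapparel_four_lt).le.trans hκ) hC₁

/-- **The volume count behind (1.93) on the concrete carrier**, unconditional in the geometry (leaf c₀ = 4·2^d proved by
b01): cover of a cell family U (v ≤ #U) by the small parts and the X_j-families, and a₁, a₀ ≥ 4·2^d, give `P.Vol193 K`.
[cite: Balaban1989LargeFieldII, (1.93) p.388] -/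
theorem vol193_window (W : B14.RelTreeLength.Window d) {LF : Type*} (P : B16Ineq197.Polymer LF W.relSys.Dom)
    (K : B16Ineq197.Consts) (hdY : ∀ Y ∈ P.Ycat, P.dY Y = W.relSys.dRel Y)
    (U : Finset (Cell W.B)) (hUv : P.v ≤ U.card) (Xc : LF → Finset (Cell W.B))
    (hvol : ∀ j ∈ P.cand, ((Xc j).card : ℝ) ≤ P.vol j)
    (hcover : ∀ p ∈ P.adm, ∀ c ∈ U, (∃ Y ∈ p.2, c.1 ∈ Y.1 ∧ c.1 ∉ W.Z) ∨ ∃ j ∈ p.1, c ∈ Xc j)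
    (ha₁ : 4 * 2 ^ d ≤ K.a₁) (ha₀ : 4 * 2 ^ d ≤ K.a₀) : P.Vol193 K :=
  vol193_of_relAnimalLeaf W.relCubeSys W.relAnimalLeaf (by positivity) P K hdY U hUv Xc hvol
    (fun p hp c hc => (hcover p hp c hc).imp
      (fun ⟨Y, hY, h⟩ => ⟨Y, hY, W.mem_small_iff.2 h⟩) id) ha₁ ha₀

/-! ## Part F. Non-vacuity: a two-cube abstract carrier -/

/-- A one-domain relative system (relative size 0, meeting the large-field region); an `abbrev`, so that `toyS.Dom`
unfolds to `Unit` for instance search. [folklore] -/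
abbrev toyS : B16.RelDomainSys where
  Dom := Unit
  dj := fun _ => 0
  dj_nonneg := fun _ => le_rfl
  dRel := fun _ => 0
  MeetsLF := fun _ => True
  dRel_nonneg := fun _ => le_rfl
  dRel_le := fun _ => le_rfl
  dRel_eq_of_not_meets := fun _ h => (h trivial).elim

/-- A two-cube relative cube system over `toyS`: cubes `true` (small field: Ω = both, Λ = {true}, Λ⁰ = ∅) and `false`
(the large-field cube, Z = {false}), adjacent to each other; the one domain consists of both cubes and is admissible
(an `abbrev`: `toyG.Cube` unfolds to `Bool`). [folklore] -/
abbrev toyG : RelCubeSystem toyS where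
  Cube := Bool
  Adj := fun a b => a ≠ b
  adj_symm := fun _ _ h => Ne.symm h
  nbr := fun a => {!a}
  mem_nbr := fun a b h => by
    cases a <;> cases b <;> simp_all
  cubes := fun _ => Finset.univ
  cubes_injective := fun a b _ => Subsingleton.elim a b
  connected := fun _ => ⟨Finset.univ_nonempty, fun v _ w _ => by
    by_cases h : v = w
    · subst h; exact Relation.ReflTransGen.refl
    · exact Relation.ReflTransGen.single ⟨h, Finset.mem_univ _, Finset.mem_univ _⟩⟩
  Omega := Finset.univ
  Lam := {true}
  Lam0 := ∅
  Z := {false}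
  lam_subset_omega := Finset.subset_univ _
  lam0_subset_lam := Finset.empty_subset _
  layer := fun a ha => absurd ha (Finset.notMem_empty a)
  mem_Z_iff := fun a => by
    cases a <;> simp
  adm := {()}
  glued := fun _ _ _ _ _ b _ _ => Finset.mem_univ b
  meets_omega := fun _ _ => ⟨false, Finset.mem_univ _, Finset.mem_univ _⟩
  meets_Ztilde := fun _ _ => ⟨false, Finset.mem_univ _, Or.inl (Finset.mem_singleton_self _)⟩

/-- The toy carrier has degree ≤ 1. [folklore] -/
theorem toyG_degreeLE : toyG.DegreeLE 1 := fun a => (Finset.card_singleton (!a)).le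

/-- The small part of the toy domain is the cube `true`. [folklore] -/
theorem toyG_small (X : toyS.Dom) : toyG.small X = {true} := by
  ext a
  rw [RelCubeSystem.mem_small]
  cases a <;> simp [toyG]

/-- The toy carrier satisfies the animal leaf with `c₀ = 1` (animal = {true}). [folklore] -/
theorem toyG_leaf : toyG.RelAnimalLeaf 1 := by
  intro X _
  refine ⟨{true}, (toyG_small X).le, fun a _ => Finset.mem_univ a, ⟨Finset.singleton_nonempty _, ?_⟩, ?_⟩
  · intro v hv w hw
    rw [Finset.mem_singleton] at hv hw
    subst hv; subst hw
    exact Relation.ReflTransGen.refl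
  · show (({true} : Finset Bool).card : ℝ) ≤ 1 * (1 + 0)
    simp

/-- The toy polymer over `toyS`: no class-1 candidates, the one domain as the catalogue, one admissible pair (∅, {Y}),
v = 1, dY = 0. [folklore] -/
def toyP : B16Ineq197.Polymer Unit toyS.Dom where
  cand := ∅
  Ycat := {()}
  adm := {(∅, {()})}
  dX := 0
  v := 1
  dY := fun _ => 0
  treeX := fun _ => 0
  vol := fun _ => 0
  adm_fst := fun p hp => by
    rw [Finset.mem_singleton] at hp
    subst hp
    exact Finset.Subset.refl _
  adm_snd := fun p hp => by
    rw [Finset.mem_singleton] at hp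
    subst hp
    exact Finset.Subset.refl _
  v_nonneg := by norm_num
  dY_nonneg := fun _ _ => le_rfl

/-- Toy constants: α = 1, β = 1, κ = 2·kapparel(1,1), C₁ = K_rel(1,1), a₁ = a₀ = 1 (the rest 0). [folklore] -/
def toyK : B16Ineq197.Consts where
  α := 1
  β := 1
  κ := 2 * kapparel 1 1
  p0 := 0
  β₀ := 0
  s := 0
  E := 0
  lam := 0
  a₁ := 1
  a₀ := 1
  cJ := 0
  C₁ := Krel 1 1
  ρ := 0

/-- **Non-vacuity of `anch194_of_sumsum`**: on the toy carrier (anchor U′ = {true}, #U′ = 1 = v) all hypotheses hold and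
the conclusion is the toy polymer's `Anch194`. [folklore] -/
theorem toy_anch194 : toyP.Anch194 toyK :=
  anch194_of_sumsum toyG toyG_degreeLE toyG_leaf toyP toyK (by norm_num [toyK]) (fun _ h => h) (fun _ _ => rfl)
    {true} (fun c hc => by
      rw [Finset.mem_singleton] at hc
      subst hc
      simp [toyG])
    (by simp [toyP]) (fun _ _ => ⟨true, Finset.mem_singleton_self _, Finset.mem_univ _⟩)
    (le_of_eq (by simp only [toyK]; ring)) le_rfl

/-- **Non-vacuity of `vol193_of_relAnimalLeaf`**: on the toy carrier (U = {true}, v = 1 ≤ 1, no X_j) all hypotheses hold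
and the conclusion is the toy polymer's `Vol193`. [folklore] -/
theorem toy_vol193 : toyP.Vol193 toyK :=
  vol193_of_relAnimalLeaf toyG toyG_leaf zero_le_one toyP toyK (fun _ _ => rfl) {true} (by simp [toyP])
    (fun _ => ∅) (fun j hj => absurd hj (Finset.notMem_empty j))
    (fun p hp c hc => by
      refine Or.inl ⟨(), ?_, ?_⟩
      · rw [Finset.mem_singleton.1 hp]
        exact Finset.mem_singleton_self _
      · rw [toyG_small]
        exact hc)
    le_rfl le_rfl

end

end Literature.MathematicalPhysics.QuantumFieldTheory.Balaban1983to89.B16Ineq197RelCubes
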